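import Mathlib.RingTheory.RootsOfUnity.Basic
import Literature.NumberTheory.EllipticCurves.TateFormLevels
import Literature.NumberTheory.EllipticCurves.ReductionHomomorphism
import Literature.NumberTheory.EllipticCurves.SingularCubic
import Literature.NumberTheory.EllipticCurves.GoodReductionInertia
import Literature.NumberTheory.EllipticCurves.VariableChangePointsMap
import HarnessLib

/-!
# Tate forms over a valued field: reduction to the node, `E₀`, and the torsion class bound

Topic `NumberTheory/EllipticCurves`. Continuation of `TateFormLevels`: `(L, w)` is a field with an
`ℝ≥0`-valued valuation, `𝒪_w = w.integer` its valuation ring with residue field `κ`, and `M` a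
Weierstrass equation over `𝒪_w` whose generic fibre `T = M_L` is in Tate form
(`TateForm.IsTateForm w T`: `y² + xy = x³ + a₄x + a₆`, `|a₄| ≤ |a₆| < 1`). Then:

* `TateForm.map_residue_eq_singularModel`: the reduction `M̃` **is** the split nodal cubic
  `y² + xy = x³ = singularModel 0 0 0 (-1)` of `SingularCubic` (node `(0,0)`, tangent slopes
  `0 ≠ -1`), so Silverman's node map (`singularModel.nodeHom`, *AEC* III.2.5(a)) composed with
  the tree's reduction homomorphism `E₀(L) → M̃_ns(κ)` (`WeierstrassCurve.reductionHom`,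
  *AEC* VII.2.1) is a homomorphism `TateForm.toUnits : E₀(L) →+ κˣ` with kernel `E₁(L)`
  (`TateForm.toUnits_eq_zero_iff`);
* `TateForm.isSmall_iff_not_hasNonsingularReduction`: the "small" points of `TateFormLevels`
  (`|x| < 1`) are exactly the points outside `E₀(L)` (the only singular point of `M̃` is the node);
* `TateForm.ncard_le_of_torsion` (**the torsion class bound**): let `n` be odd with `|n| = 1`
  and let `G ≤ T(L)` be a subgroup killed by `n` such that every small point `(x, y) ∈ G` with
  `|x|² > |a₆|` has `|x| = c^m` for some `m ≥ 1`, where `0 < c < 1` and `|a₆| = c^N`. Then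
  `#G ≤ n · (2N + 1)`. Proof: `G ∩ E₀` has at most `n` elements (`E₁` has no `n`-torsion by
  `val_le_one_of_zsmul_eq_zero`, *AEC* VII.3.1, so `G ∩ E₀ ↪ κˣ[n]`, at most `n` roots of
  `Xⁿ - 1`); no point of `G` is "middle" (`TateForm.not_isSmall_two_nsmul_of_middle`: `2P ∈ E₀`
  forces `P = ((n+1)/2)·2P ∈ E₀`); and the small points of `G` with a given level `m ≤ N` and
  branch form a single coset of `G ∩ E₀` (`TateForm.not_isSmall_sub_of_branch₀/₁`). This is the
  elementary shadow of `E_q(K)[n] / (E_q(K)[n] ∩ E₀) ↪ E_q(K)/E_{q,0}(K) ≅ ℤ/v(q)ℤ`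
  (Silverman, *ATAEC*, Cor. IV.9.2(d), V.4.1) used in the proof of the criterion of
  Néron–Ogg–Shafarevich (*AEC* Thm. VII.7.1) at a place of multiplicative reduction.

Consumer: `PotentiallyMultiplicativeRamifiedTorsion` (number-field instance: `T` the Tate form of
invariant `j(E)` at a place with `|j|_v > 1`, `G` the `n`-torsion, `c = |ϖ|_v`, the levels being
integral because the abscissae of the torsion lie in `K_v^nr` when the torsion is unramified).

## Relation to the tree

`ReductionHomomorphismCuspNodeProofs` (same setting `W : WeierstrassCurve w.integer`,
`w : Valuation L ℝ≥0`, but importing the Hensel/surjectivity material) already has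
`WeierstrassCurve.ReducesToZero.eq_zero_of_zsmul_eq_zero` (of which
`TateForm.not_reducesToZero_of_zsmul_eq_zero` below is the contrapositive, re-derived here in
three lines from `val_le_one_of_zsmul_eq_zero` to keep the imports light),
`eq_of_reducePoint_eq_of_zsmul_eq_zero` (the content of `TateForm.eq_of_toUnits_eq` before
composing with `nodeHom_injective`) and the existential `exists_addMonoidHom_units_of_node`
(a homomorphism `E₀ → k̄ˣ` with kernel `E₁` for nodal reduction); `TateForm.toUnits` is its
concrete, `κˣ`-valued refinement for the *split* node of a Tate form. The counting lemmas for
roots of unity are Mathlib's `rootsOfUnity` / `card_rootsOfUnity`.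

## References

* [SilvermanAEC2009] J. H. Silverman, *The Arithmetic of Elliptic Curves*, 2nd ed., GTM 106,
  Springer 2009: Prop. III.2.5(a), Prop. VII.2.1, Prop. VII.3.1(a), proof of Thm. VII.7.1
  (PDF pp. 59, 167, 170, 178–179).
* [SilvermanATAEC1994] J. H. Silverman, *Advanced Topics in the Arithmetic of Elliptic Curves*,
  GTM 151, Springer 1994: Cor. IV.9.2(d), V.4 Prop. 4.1 and Lemmas 4.1.1–4.1.4.

## Design

`noncomputable section`, `open scoped Classical NNReal`; one definition (`TateForm.toUnits`),
theorems otherwise; the valuation ring is Mathlib's `w.integer` with `Valuation.integer.integers w`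
feeding the `hv` arguments of `ReductionHomomorphism`.
-/

noncomputable section

open scoped Classical NNReal

universe u

namespace Literature.NumberTheory.EllipticCurves

namespace TateForm

open _root_.WeierstrassCurve

/-! ## The split node `y² + xy = x³` -/

section Node

variable {k : Type u} [Field k]

/-- `singularModel 0 0 0 (-1)` is the Weierstrass cubic `y² + xy = x³` (`a₁ = 1`, all other
`aᵢ = 0`). [folklore] -/
theorem singularModel_node_eq : singularModel (0 : k) 0 0 (-1) = ⟨1, 0, 0, 0, 0⟩ := by
  ext <;> simp [singularModel]

/-- On `y² + xy = x³` the node `(0, 0)` is the only singular point: a point of the curve with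
`x ≠ 0` is nonsingular (if `y = 3x²` and `2y + x = 0` on the curve then `6x = -1`, `9x = -2`,
so `1 = 0`). Silverman, *AEC*, Prop. III.1.4(a) and III.2.5. [folklore] -/
theorem nonsingular_node_of_x_ne_zero {x y : k}
    (he : (singularModel (0 : k) 0 0 (-1)).toAffine.Equation x y) (hx : x ≠ 0) :
    (singularModel (0 : k) 0 0 (-1)).toAffine.Nonsingular x y := by
  rw [singularModel_node_eq] at he ⊢
  rw [WeierstrassCurve.Affine.nonsingular_iff']
  refine ⟨he, ?_⟩
  rw [WeierstrassCurve.Affine.equation_iff] at he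
  by_contra h
  push Not at h
  obtain ⟨hX, hY⟩ := h
  have hy : y = 3 * x ^ 2 := by linear_combination hX
  subst hy
  have h1 : x * (6 * x + 1) = 0 := by linear_combination hY
  have h2 : x ^ 3 * (9 * x + 2) = 0 := by linear_combination he
  have h1' : 6 * x + 1 = 0 := (mul_eq_zero.mp h1).resolve_left hx
  have h2' : 9 * x + 2 = 0 := (mul_eq_zero.mp h2).resolve_left (pow_ne_zero 3 hx)
  have : (1 : k) = 0 := by linear_combination -(3 * h1' - 2 * h2')
  exact one_ne_zero this

end Node

/-! ## The integral model of a Tate form and its reduction -/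

section Reduction

variable {L : Type u} [Field L] {w : Valuation L ℝ≥0} {M : WeierstrassCurve w.integer}

/-- **A Tate form reduces to the split node**: if `M_L` is in Tate form then
`M̃ = M mod 𝔪_w` is `y² + xy = x³ = singularModel 0 0 0 (-1)` (`ā₄ = ā₆ = 0`).
[cite: SilvermanATAEC1994, V.3 Thm. 3.1] -/
theorem map_residue_eq_singularModel (hT : IsTateForm w (M.baseChange L)) :
    M.map (IsLocalRing.residue w.integer) =
      singularModel (0 : IsLocalRing.ResidueField w.integer) 0 0 (-1) := by
  have h₁ : M.a₁ = 1 := Subtype.ext (by simpa using hT.a₁)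
  have h₂ : M.a₂ = 0 := Subtype.ext (by simpa using hT.a₂)
  have h₃ : M.a₃ = 0 := Subtype.ext (by simpa using hT.a₃)
  have hv := Valuation.integer.integers w
  have h₄ : IsLocalRing.residue w.integer M.a₄ = 0 :=
    (v_algebraMap_lt_one_iff hv M.a₄).mp (hT.w_a₄_le.trans_lt hT.w_a₆_lt)
  have h₆ : IsLocalRing.residue w.integer M.a₆ = 0 :=
    (v_algebraMap_lt_one_iff hv M.a₆).mp hT.w_a₆_lt
  rw [singularModel_node_eq]
  ext <;> simp [h₁, h₂, h₃, h₄, h₆]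

/-- **Small = singular reduction.** For `M_L` in Tate form, a point is small (`|x| < 1`, file
`TateFormLevels`) iff it does not have nonsingular reduction, i.e. iff it lies outside `E₀(L)`:
a point with `|x| < 1` has `|y| < 1` and reduces to the node `(0, 0)`; a point with `|x| > 1`
reduces to `Õ`; a point with `|x| = 1` reduces to a point of `M̃` with `x̄ ≠ 0`, which is
nonsingular. Silverman, *ATAEC*, Lemma V.4.1.1; *AEC* VII.2.
[cite: SilvermanATAEC1994, Lemma V.4.1.1 (PDF p. 402)] -/
theorem isSmall_iff_not_hasNonsingularReduction (hT : IsTateForm w (M.baseChange L))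
    (P : (M.baseChange L).toAffine.Point) :
    IsSmall w P ↔ ¬ M.HasNonsingularReduction P := by
  have hv := Valuation.integer.integers w
  rcases P with _ | ⟨x, y, h⟩
  · exact ⟨fun h => False.elim h, fun h => (h WeierstrassCurve.hasNonsingularReduction_zero).elim⟩
  · rw [isSmall_some]
    constructor
    · intro hx hns
      rcases hns with hxr | ⟨x₀, y₀, hx₀, hy₀, hns⟩
      · exact hxr ⟨⟨x, hx.le⟩, rfl⟩
      · have hy : w y < 1 := w_y_lt_one hT h.1 hx
        have ex : IsLocalRing.residue w.integer x₀ = 0 := by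
          apply (v_algebraMap_lt_one_iff hv x₀).mp
          rwa [hx₀]
        have ey : IsLocalRing.residue w.integer y₀ = 0 := by
          apply (v_algebraMap_lt_one_iff hv y₀).mp
          rwa [hy₀]
        rw [map_residue_eq_singularModel hT, ex, ey] at hns
        exact singularModel.not_nonsingular_S 0 0 0 (-1) hns
    · intro hns
      by_contra hx
      rw [not_lt] at hx
      apply hns
      rcases hx.lt_or_eq with hlt | heq
      · exact Or.inl ((not_mem_range_iff hv).mpr hlt)
      · have hy : w y ≤ 1 := v_Y_le_one_of_v_X_le_one hv h.1 heq.ge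
        refine Or.inr ⟨⟨x, heq.ge⟩, ⟨y, hy⟩, rfl, rfl, ?_⟩
        rw [map_residue_eq_singularModel hT]
        have he : M.toAffine.Equation ⟨x, heq.ge⟩ ⟨y, hy⟩ := (map_equation_iff hv.hom_inj).mp h.1
        have he' := WeierstrassCurve.Affine.Equation.map (IsLocalRing.residue w.integer) he
        rw [show (M.toAffine.map (IsLocalRing.residue w.integer)) =
            (M.map (IsLocalRing.residue w.integer)).toAffine from rfl,
          map_residue_eq_singularModel hT] at he'
        exact nonsingular_node_of_x_ne_zero he'
          ((v_algebraMap_eq_one_iff hv (⟨x, heq.ge⟩ : w.integer)).mp heq.symm)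

/-! ## The homomorphism `E₀(L) → κˣ` -/

/-- **The reduction of `E₀(L)` into `κˣ`** for a Tate form: the tree's reduction homomorphism
`E₀(L) → M̃_ns(κ)` (`WeierstrassCurve.reductionHom`, Silverman, *AEC* VII.2.1) followed by the
identification `M̃ = singularModel 0 0 0 (-1)` and Silverman's node map
`(x, y) ↦ y/(y + x)` (`singularModel.nodeHom`, *AEC* III.2.5(a); written additively). Compare the
existential `WeierstrassCurve.exists_addMonoidHom_units_of_node` of
`ReductionHomomorphismCuspNodeProofs` (into `k̄ˣ`, any node).
[cite: SilvermanAEC2009, Prop. III.2.5(a) and Prop. VII.2.1] -/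
def toUnits (hT : IsTateForm w (M.baseChange L)) :
    M.nonsingularReductionSubgroup (Valuation.integer.integers w) →+
      Additive (IsLocalRing.ResidueField w.integer)ˣ :=
  (singularModel.nodeHom (0 : IsLocalRing.ResidueField w.integer) 0 0 (-1)).comp
    (((Affine.Point.congrEquiv (map_residue_eq_singularModel hT)).toAddMonoidHom).comp
      (M.reductionHom (Valuation.integer.integers w)))

/-- The kernel of `E₀(L) → κˣ` is `E₁(L)`: `toUnits P = 0 ↔ P` reduces to `Õ`
(`reductionHom_ker`, and `nodeHom` is injective since the tangent slopes `0 ≠ -1`).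
[cite: SilvermanAEC2009, Prop. VII.2.1 and Prop. III.2.5(a)] -/
theorem toUnits_eq_zero_iff (hT : IsTateForm w (M.baseChange L))
    (P : M.nonsingularReductionSubgroup (Valuation.integer.integers w)) :
    toUnits hT P = 0 ↔ M.ReducesToZero (P : (M.baseChange L).toAffine.Point) := by
  have hv := Valuation.integer.integers w
  have hα : (0 : IsLocalRing.ResidueField w.integer) ≠ -1 := by
    rw [Ne, eq_comm, neg_eq_zero]; exact one_ne_zero
  rw [toUnits, AddMonoidHom.comp_apply, AddMonoidHom.comp_apply,
    ← (singularModel.nodeHom (0 : IsLocalRing.ResidueField w.integer) 0 0 (-1)).map_zero,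
    (singularModel.nodeHom_injective hα).eq_iff, AddEquiv.coe_toAddMonoidHom,
    AddEquiv.map_eq_zero_iff, WeierstrassCurve.reductionHom_apply]
  exact WeierstrassCurve.reducePoint_eq_zero_iff hv P.2

/-- An affine torsion point of order prime to the residue characteristic (`n • P = O`, `|n| = 1`)
is `w`-integral, hence does not reduce to `Õ` (Silverman, *AEC*, Prop. VII.3.1(a): `E₁` has no
prime-to-`p` torsion; tree `val_le_one_of_zsmul_eq_zero`; this is the contrapositive of the tree's
`WeierstrassCurve.ReducesToZero.eq_zero_of_zsmul_eq_zero`, `ReductionHomomorphismCuspNodeProofs`).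
[cite: SilvermanAEC2009, Prop. VII.3.1(a)] -/
theorem not_reducesToZero_of_zsmul_eq_zero {n : ℤ} (hn : w n = 1) {x y : L}
    {h : (M.baseChange L).toAffine.Nonsingular x y} (h0 : n • (Affine.Point.some x y h) = 0) :
    ¬ M.ReducesToZero (Affine.Point.some x y h) := by
  haveI : (M.baseChange L).IsIntegral w.integer := ⟨M, rfl⟩
  have hx : w x ≤ 1 := val_le_one_of_zsmul_eq_zero hn h0
  rw [WeierstrassCurve.reducesToZero_some_iff, not_mem_range_iff (Valuation.integer.integers w),
    not_lt]
  exact hx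

/-! ## Counting: at most `n` roots of unity, and the torsion class bound -/

/-- A field has at most `n` `n`-th roots of unity (`n ≥ 1`): the set `{ζ : κˣ | ζⁿ = 1}` is
(the coercion of) Mathlib's `rootsOfUnity n κ`, which is finite with `Nat.card ≤ n`
(`card_rootsOfUnity`). [folklore] -/
theorem _root_.Literature.NumberTheory.EllipticCurves.ncard_units_pow_eq_one_le
    {k : Type*} [Field k] {n : ℕ} (hn : 0 < n) :
    ({ζ : kˣ | ζ ^ n = 1} : Set kˣ).Finite ∧ ({ζ : kˣ | ζ ^ n = 1} : Set kˣ).ncard ≤ n := by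
  haveI : NeZero n := ⟨hn.ne'⟩
  have h : ({ζ : kˣ | ζ ^ n = 1} : Set kˣ) = ((rootsOfUnity n k : Subgroup kˣ) : Set kˣ) := by
    ext ζ
    simp [mem_rootsOfUnity]
  rw [h]
  haveI : Finite (((rootsOfUnity n k : Subgroup kˣ) : Set kˣ)) :=
    (inferInstance : Finite (rootsOfUnity n k))
  refine ⟨Set.toFinite _, ?_⟩
  rw [← Nat.card_coe_set_eq]
  exact card_rootsOfUnity k n

/-! ## The torsion class bound -/

section ClassBound

variable (hT : IsTateForm w (M.baseChange L)) {n : ℕ} (hn : w n = 1)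
  (G : AddSubgroup (M.baseChange L).toAffine.Point) (hG : ∀ P ∈ G, n • P = 0)
include hT hn hG

/-- In an `n`-torsion subgroup (`|n| = 1`), two points of `E₀` with the same image in `κˣ` are
equal: their difference lies in `E₁`, which has no `n`-torsion (*AEC* VII.3.1(a)). [folklore] -/
theorem eq_of_toUnits_eq {P Q : (M.baseChange L).toAffine.Point} (hP : P ∈ G) (hQ : Q ∈ G)
    (hP₀ : M.HasNonsingularReduction P) (hQ₀ : M.HasNonsingularReduction Q)
    (h : toUnits hT ⟨P, hP₀⟩ = toUnits hT ⟨Q, hQ₀⟩) : P = Q := by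
  have hv := Valuation.integer.integers w
  have hsub : toUnits hT (⟨P, hP₀⟩ - ⟨Q, hQ₀⟩) = 0 := by rw [map_sub, h, sub_self]
  rw [toUnits_eq_zero_iff] at hsub
  change M.ReducesToZero (P - Q) at hsub
  have hPQ : P - Q ∈ G := G.sub_mem hP hQ
  rcases hPQ' : P - Q with _ | ⟨x, y, hxy⟩
  · exact sub_eq_zero.mp (hPQ'.trans (WeierstrassCurve.Affine.Point.zero_def).symm)
  · exfalso
    rw [hPQ'] at hsub hPQ
    have h0 : (n : ℤ) • (Affine.Point.some x y hxy) = 0 := by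
      rw [natCast_zsmul]; exact hG _ hPQ
    exact not_reducesToZero_of_zsmul_eq_zero (by exact_mod_cast hn) h0 hsub

/-- In an `n`-torsion subgroup (`|n| = 1`), the points of `E₀` number at most `n`: they embed
into the `n`-th roots of unity of the residue field. [cite: SilvermanAEC2009, Prop. VII.3.1(a),(b)] -/
theorem ncard_hasNonsingularReduction_le :
    {P | P ∈ G ∧ M.HasNonsingularReduction P}.ncard ≤ n := by
  have hn0 : 0 < n := by
    rcases Nat.eq_zero_or_pos n with rfl | h
    · rw [Nat.cast_zero, map_zero] at hn; exact absurd hn zero_ne_one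
    · exact h
  set f : (M.baseChange L).toAffine.Point → (IsLocalRing.ResidueField w.integer)ˣ := fun P =>
    if hP : M.HasNonsingularReduction P then Additive.toMul (toUnits hT ⟨P, hP⟩) else 1 with hf
  obtain ⟨hfin, hcard⟩ := ncard_units_pow_eq_one_le (k := IsLocalRing.ResidueField w.integer) hn0
  refine le_trans ?_ hcard
  refine Set.ncard_le_ncard_of_injOn f ?_ ?_ hfin
  · rintro P ⟨hPG, hP₀⟩
    simp only [Set.mem_setOf_eq, hf, dif_pos hP₀]
    rw [← toMul_nsmul, ← map_nsmul]
    have : n • (⟨P, hP₀⟩ : M.nonsingularReductionSubgroup (Valuation.integer.integers w)) = 0 :=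
      Subtype.ext (by simpa using hG P hPG)
    rw [this, map_zero, toMul_zero]
  · rintro P ⟨hPG, hP₀⟩ Q ⟨hQG, hQ₀⟩ hPQ
    simp only [hf, dif_pos hP₀, dif_pos hQ₀, Additive.toMul.injective.eq_iff] at hPQ
    exact eq_of_toUnits_eq hT hn G hG hPG hQG hP₀ hQ₀ hPQ

omit hn in
/-- In an odd-torsion subgroup no small point is "middle": if `|x|² ≤ |a₆|` then `2P ∈ E₀`
(`TateForm.not_isSmall_two_nsmul_of_middle`), hence `P = ((n+1)/2)·2P ∈ E₀`, contradicting
`|x| < 1`. (On `E_q`: the component of order `2` carries no point of odd order modulo `E₀`.)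
[cite: SilvermanATAEC1994, Cor. IV.9.2(d)] -/
theorem lt_sq_of_mem (hodd : Odd n) (ha₆ : (M.baseChange L).a₆ ≠ 0) {x y : L}
    {h : (M.baseChange L).toAffine.Nonsingular x y} (hP : Affine.Point.some x y h ∈ G)
    (hx : w x < 1) : w (M.baseChange L).a₆ < w x ^ 2 := by
  have hv := Valuation.integer.integers w
  by_contra hmid
  rw [not_lt] at hmid
  have h2 : ¬ IsSmall w (Affine.Point.some x y h + .some x y h) :=
    not_isSmall_two_nsmul_of_middle hT ha₆ h hx hmid
  rw [isSmall_iff_not_hasNonsingularReduction hT, not_not] at h2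
  obtain ⟨k, hk⟩ := hodd
  have hPeq : Affine.Point.some x y h = (k + 1) • (Affine.Point.some x y h + .some x y h) := by
    rw [← two_nsmul, ← mul_nsmul, show 2 * (k + 1) = n + 1 by omega, succ_nsmul, hG _ hP,
      zero_add]
  have hE₀ : M.HasNonsingularReduction (Affine.Point.some x y h) := by
    rw [hPeq]
    exact (M.nonsingularReductionSubgroup hv).nsmul_mem h2 _
  exact (isSmall_iff_not_hasNonsingularReduction hT _).mp
    (show IsSmall w (Affine.Point.some x y h) from hx) hE₀

/-- **The torsion class bound.** Let `M_L` be in Tate form with `a₆ ≠ 0`, `|a₆| = cᴺ` for some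
`0 < c < 1`, let `n` be odd with `|n| = 1`, and let `G` be an `n`-torsion subgroup of `M(L)`
all of whose small points `(x, y)` with `|x|² > |a₆|` have `|x| = cᵐ` for some `m ≥ 1`
("integral levels"). Then `#G ≤ n(2N + 1)`: the level-and-branch map
`G → {E₀} ⊔ {1, …, N} × {0, 1}` has fibres contained in cosets of `G ∩ E₀`, which has at most
`n` elements. This is the elementary form of
`G/(G ∩ E₀) ↪ E(K)/E₀(K) ≅ ℤ/v(Δ)ℤ` at a place of split multiplicative reduction (Silverman,
*ATAEC*, Cor. IV.9.2(d); *AEC* Thm. VII.6.1) as used in the proof of the criterion of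
Néron–Ogg–Shafarevich (*AEC* Thm. VII.7.1: "`E(K^nr)[m]` … `E(K^nr)/E₀(K^nr)` has order
strictly less than `m`"). The bound is stated with `Set.ncard`, whose value is the junk value `0`
for an infinite `G`: it is meaningful for finite `G` only (the hypotheses do force finiteness, and
the consumer `PotentiallyMultiplicativeRamifiedTorsion` applies it to the `n`-torsion, of known
finite order `n²`). [cite: SilvermanAEC2009, Thm. VII.7.1 (proof) with Thm. VII.6.1] -/
theorem ncard_le_of_torsion (hodd : Odd n) {c : ℝ≥0}
    (hc0 : 0 < c) (hc1 : c < 1) {N : ℕ} (hN : w (M.baseChange L).a₆ = c ^ N)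
    (hlev : ∀ {x y : L} (h : (M.baseChange L).toAffine.Nonsingular x y),
      Affine.Point.some x y h ∈ G → w x < 1 → w (M.baseChange L).a₆ < w x ^ 2 →
        ∃ m : ℕ, 1 ≤ m ∧ w x = c ^ m) :
    (G : Set (M.baseChange L).toAffine.Point).ncard ≤ n * (2 * N + 1) := by
  have hv := Valuation.integer.integers w
  have hn0 : 0 < n := hodd.pos
  have ha₆ : (M.baseChange L).a₆ ≠ 0 := by
    rw [← (Valuation.ne_zero_iff w), hN]
    exact pow_ne_zero _ hc0.ne'
  by_cases hfin : (G : Set (M.baseChange L).toAffine.Point).Finite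
  swap
  · rw [Set.Infinite.ncard hfin]
    exact Nat.zero_le _
  -- the level-and-branch map
  let lev : (M.baseChange L).toAffine.Point → Option (ℕ × Bool) := fun P =>
    match P with
    | .zero => none
    | .some x y _ =>
        if w x < 1 then
          some (if hm : ∃ m : ℕ, 1 ≤ m ∧ w x = c ^ m then hm.choose else 0, decide (w y < w x))
        else none
  -- (1) points of `G` in `E₀` are the points of level `none`
  have hnone : ∀ P ∈ G, lev P = none ↔ M.HasNonsingularReduction P := by
    intro P hP
    rw [← not_iff_not, ← isSmall_iff_not_hasNonsingularReduction hT]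
    rcases P with _ | ⟨x, y, h⟩
    · exact ⟨fun h => (h rfl).elim, fun h => h.elim⟩
    · simp only [lev, isSmall_some]
      by_cases hx : w x < 1
      · simp [hx]
      · simp [hx]
  -- (2) two points of `G` with the same level differ by a point of `E₀`
  have hcongr : ∀ P ∈ G, ∀ Q ∈ G, lev P = lev Q → M.HasNonsingularReduction (P - Q) := by
    intro P hP Q hQ hPQ
    by_cases hP₀ : M.HasNonsingularReduction P
    · have hQ₀ : M.HasNonsingularReduction Q := by
        rw [← hnone Q hQ, ← hPQ, hnone P hP]; exact hP₀
      exact (M.nonsingularReductionSubgroup hv).sub_mem hP₀ hQ₀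
    · have hQ₀ : ¬ M.HasNonsingularReduction Q := by
        rw [← hnone Q hQ, ← hPQ, hnone P hP]; exact hP₀
      rw [← isSmall_iff_not_hasNonsingularReduction hT] at hP₀ hQ₀
      rcases P with _ | ⟨x₁, y₁, h₁⟩
      · exact hP₀.elim
      rcases Q with _ | ⟨x₂, y₂, h₂⟩
      · exact hQ₀.elim
      rw [isSmall_some] at hP₀ hQ₀
      have hm₁ := lt_sq_of_mem hT G hG hodd ha₆ hP hP₀
      have hm₂ := lt_sq_of_mem hT G hG hodd ha₆ hQ hQ₀
      have ex₁ := hlev h₁ hP hP₀ hm₁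
      have ex₂ := hlev h₂ hQ hQ₀ hm₂
      simp only [lev, hP₀, hQ₀, if_true, dif_pos ex₁, dif_pos ex₂, Option.some.injEq,
        Prod.mk.injEq, decide_eq_decide] at hPQ
      obtain ⟨hm, hb⟩ := hPQ
      have hx : w x₁ = w x₂ := by rw [ex₁.choose_spec.2, ex₂.choose_spec.2, hm]
      rw [← not_not (a := M.HasNonsingularReduction _),
        ← isSmall_iff_not_hasNonsingularReduction hT]
      by_cases hb₁ : w y₁ < w x₁
      · exact not_isSmall_sub_of_branch₀ hT h₁ h₂ hx hP₀ hb₁ (hb.mp hb₁)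
      · have hb₂ : ¬ w y₂ < w x₂ := fun h' => hb₁ (hb.mpr h')
        have hc₁ : w (y₁ + x₁) < w x₁ :=
          ((branch hT h₁.1 hP₀ hm₁).resolve_left fun h' => hb₁ h'.1).1
        have hc₂ : w (y₂ + x₂) < w x₂ :=
          ((branch hT h₂.1 hQ₀ hm₂).resolve_left fun h' => hb₂ h'.1).1
        exact not_isSmall_sub_of_branch₁ hT h₁ h₂ hx hP₀ hc₁ hc₂
  -- (3) levels lie in `{none} ∪ {1, …, N} × Bool`
  have himage : ∀ P ∈ G, lev P ∈ insert none
      ((Finset.Icc 1 N ×ˢ (Finset.univ : Finset Bool)).image some) := by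
    intro P hP
    rcases P with _ | ⟨x, y, h⟩
    · exact Finset.mem_insert_self _ _
    · by_cases hx : w x < 1
      · have hm := lt_sq_of_mem hT G hG hodd ha₆ hP hx
        have ex := hlev h hP hx hm
        simp only [lev, hx, if_true, dif_pos ex]
        refine Finset.mem_insert_of_mem (Finset.mem_image_of_mem _ (Finset.mem_product.mpr
          ⟨Finset.mem_Icc.mpr ⟨ex.choose_spec.1, ?_⟩, Finset.mem_univ _⟩))
        -- `c^N = |a₆| < |x|² = c^(2m)` forces `2m < N`
        have hlt : c ^ N < c ^ (2 * ex.choose) := by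
          rw [← hN, mul_comm, pow_mul, ← ex.choose_spec.2]
          exact hm
        have := (pow_lt_pow_iff_right_of_lt_one₀ hc0 hc1).mp hlt
        omega
      · simp only [lev, hx, if_false]
        exact Finset.mem_insert_self _ _
  -- counting
  set s := hfin.toFinset with hs
  have hsG : ∀ P, P ∈ s ↔ P ∈ G := fun P => by simp [hs]
  have hHfin : ({P | P ∈ G ∧ M.HasNonsingularReduction P} : Set _).Finite :=
    hfin.subset fun P hP => hP.1
  have hfib : ∀ b ∈ s.image lev, (s.filter (fun P => lev P = b)).card ≤ n := by
    intro b hb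
    obtain ⟨Q₀, hQ₀s, rfl⟩ := Finset.mem_image.mp hb
    have hQ₀ : Q₀ ∈ G := (hsG Q₀).mp hQ₀s
    refine le_trans ?_ (ncard_hasNonsingularReduction_le hT hn G hG)
    rw [Set.ncard_eq_toFinset_card _ hHfin]
    refine Finset.card_le_card_of_injOn (fun P => P - Q₀) ?_ ?_
    · intro P hP
      rw [Finset.mem_coe, Finset.mem_filter] at hP
      rw [Finset.mem_coe, Set.Finite.mem_toFinset]
      exact ⟨G.sub_mem ((hsG P).mp hP.1) hQ₀, hcongr P ((hsG P).mp hP.1) Q₀ hQ₀ hP.2⟩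
    · intro P _ P' _ hPP'
      exact sub_left_injective hPP'
  have himg : (s.image lev).card ≤ 2 * N + 1 := by
    calc (s.image lev).card
        ≤ (insert none ((Finset.Icc 1 N ×ˢ (Finset.univ : Finset Bool)).image some)).card := by
          refine Finset.card_le_card fun b hb => ?_
          obtain ⟨P, hPs, rfl⟩ := Finset.mem_image.mp hb
          exact himage P ((hsG P).mp hPs)
      _ ≤ ((Finset.Icc 1 N ×ˢ (Finset.univ : Finset Bool)).image some).card + 1 :=
          Finset.card_insert_le _ _
      _ ≤ (Finset.Icc 1 N ×ˢ (Finset.univ : Finset Bool)).card + 1 := by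
          gcongr; exact Finset.card_image_le
      _ = 2 * N + 1 := by
          rw [Finset.card_product, Nat.card_Icc, Finset.card_univ, Fintype.card_bool]
          omega
  calc (G : Set (M.baseChange L).toAffine.Point).ncard = s.card :=
        Set.ncard_eq_toFinset_card _ hfin
    _ ≤ n * (s.image lev).card := Finset.card_le_mul_card_image s n hfib
    _ ≤ n * (2 * N + 1) := Nat.mul_le_mul_left n himg

end ClassBound

end Reduction

end TateForm

end Literature.NumberTheory.EllipticCurves

end
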